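/-
# Solo-blind programme on Kontsevich–Zagier, s6 part T3d: Landen's identity inside the rules

Continuing `SoloBlindLandenChart` (`[D⁻(w)] = [D(u)] + [C(u)]`, `u = w/(1+w)`): the
co-dilogarithm cell `C(u) = [0 < q₁ < q₀ < u, dq/((1−q₀)(1−q₁))]` has a *symmetric* form, so

* move (1a) + a permutation move: `2[C(u)] = [(0,u)², dq/((1−q₀)(1−q₁))]` (the square is `C(u)`,
  its mirror image, and a null diagonal — the diagonal is a proper linear subspace);
* move (2): the affine chart `vᵢ = (1−qᵢ)/(1−u)` maps the square onto the logarithmic box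
  `(1, 1/(1−u))²` with the form `dv/(v₀v₁)`, of class `ℓ(1/(1−u))² = ℓ(1+w)²`
  (`SoloBlindDilogEuler.mkQ_logBox`).

Hence **Landen's identity as an identity of KZ classes** (`two_nsmul_mkQ_dilogNeg`): for every
real algebraic `w > 0`,

  `2·[D⁻(w)] = 2·[D(w/(1+w))] + ℓ(1+w)²`  in `Q = FormalRep/relations`,

whose period shadow is `−Li₂(−w) = Li₂(w/(1+w)) + ½ log²(1+w)` (`dilogNeg_value`).
-/
import Summits.KontsevichZagierPeriods.KontsevichZagierPeriods.Theorems.SoloBlindLandenChart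

noncomputable section

open MeasureTheory Set MvPolynomial
open Literature.NumberTheory.Transcendental
open Literature.NumberTheory.Transcendental.KZ
open Literature.NumberTheory.Transcendental.KZ.IntegralRep
open Literature.ModelTheory.ExponentialFields (IsSemialgebraic isSemialgebraic_setOf_eval_pos)

namespace Summit.KontsevichZagierPeriods.KontsevichZagierPeriods.Theorems

namespace SoloBlind

variable (c : Cut)

/-! ## The co-square `(0,u)²` and its dissection along the diagonal -/

/-- The open square `(0,u)²`. -/
def coSqDom : Set (Fin 2 → ℝ) := {q | 0 < q 0 ∧ q 0 < c.x ∧ 0 < q 1 ∧ q 1 < c.x}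

/-- It is semialgebraic. -/
theorem isSemialgebraic_coSqDom : IsSemialgebraic ℚ (coSqDom c) := by
  have h : {q : Fin 2 → ℝ | 0 < q 0 ∧ 0 < q 1} =
      {q | 0 < aeval q (X 0 : MvPolynomial (Fin 2) ℚ)} ∩
        {q | 0 < aeval q (X 1 : MvPolynomial (Fin 2) ℚ)} := by
    ext q; simp
  have h1 : IsSemialgebraic ℚ {q : Fin 2 → ℝ | 0 < q 0 ∧ 0 < q 1} := by
    rw [h]; exact (isSemialgebraic_setOf_eval_pos _).inter (isSemialgebraic_setOf_eval_pos _)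
  have h2 := isSemialgebraic_sep_apply_lt h1 0 c.alg
  convert isSemialgebraic_sep_apply_lt h2 1 c.alg using 1
  ext q; simp only [coSqDom, mem_setOf_eq]; tauto

/-- `coFun` is integrable on the square (continuous on the closed square, `u < 1`). -/
theorem integrableOn_coFun_coSq : IntegrableOn coFun (coSqDom c) := by
  have hu := c.lt_one
  have hK : IntegrableOn coFun (Icc ![0, 0] ![c.x, c.x]) := by
    refine ContinuousOn.integrableOn_compact isCompact_Icc ?_
    refine continuousOn_const.div (by fun_prop) fun q hq => ?_
    have a0 : q 0 ≤ c.x := by simpa using hq.2 0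
    have a1 : q 1 ≤ c.x := by simpa using hq.2 1
    exact mul_ne_zero (by linarith) (by linarith)
  refine hK.mono_set fun q hq => ⟨fun i => ?_, fun i => ?_⟩
  · fin_cases i
    · simpa using hq.1.le
    · simpa using hq.2.2.1.le
  · fin_cases i
    · simpa using hq.2.1.le
    · simpa using hq.2.2.2.le

/-- **The co-square** `[(0,u)², dq/((1−q₀)(1−q₁))]`. -/
def coSq : IntegralRep 2 :=
  ratRep (coSqDom c) coFun 1 ((1 - X 0) * (1 - X 1)) (isSemialgebraic_coSqDom c)
    (fun q hq => by
      have := hq.2.1; have := hq.2.2.2; have := c.lt_one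
      simpa using mul_ne_zero (by linarith : 1 - q 0 ≠ 0) (by linarith : 1 - q 1 ≠ 0))
    (fun q _ => by simp [coFun]) (integrableOn_coFun_coSq c)

/-- **Dissection of the co-square** (rule (1a)): `[(0,u)²] − [C(u)] − [C(u)ᵗ]` is a relation,
where `C(u)ᵗ` is `C(u)` with the coordinates swapped. -/
theorem coSq_dissect : of (coSq c) - of (coRep c) - of ((coRep c).reindex (Equiv.swap 0 1)) ∈
    relations := by
  let R : Fin 2 → IntegralRep 2 := ![coRep c, (coRep c).reindex (Equiv.swap 0 1)]
  have hsub : ∀ i, (R i).domain ⊆ coSqDom c := by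
    intro i q hq
    fin_cases i
    · change q ∈ cutDom c at hq
      obtain ⟨h1, h2, h3⟩ := hq
      exact ⟨h1.trans h2, h3, h1, h2.trans h3⟩
    · change (fun j => q (Equiv.swap (0 : Fin 2) 1 j)) ∈ cutDom c at hq
      simp only [cutDom, mem_setOf_eq, Equiv.swap_apply_left, Equiv.swap_apply_right] at hq
      obtain ⟨h1, h2, h3⟩ := hq
      exact ⟨h1, h2.trans h3, h1.trans h2, h3⟩
  have h := of_sub_sum_of_mem_relations (Finset.univ : Finset (Fin 2)) (coSq c) R
    (fun i _ => measure_mono_null (fun q hq => absurd (hsub i hq.1) hq.2) measure_empty)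
    (fun i _ q _ => ?_) ?_ ?_
  · have e : ∑ i : Fin 2, of (R i) = of (coRep c) + of ((coRep c).reindex (Equiv.swap 0 1)) := by
      rw [Fin.sum_univ_two]; rfl
    rw [e] at h; convert h using 1; abel
  · fin_cases i
    · rfl
    · show coFun (fun j => q (Equiv.swap (0 : Fin 2) 1 j)) = coFun q
      simp only [coFun, Equiv.swap_apply_left, Equiv.swap_apply_right, mul_comm]
  · have hdiag : volume {q : Fin 2 → ℝ | q 0 = q 1} = 0 := by
      let L : (Fin 2 → ℝ) →ₗ[ℝ] ℝ :=
        LinearMap.proj (R := ℝ) (φ := fun _ : Fin 2 => ℝ) 0 -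
          LinearMap.proj (R := ℝ) (φ := fun _ : Fin 2 => ℝ) 1
      have hS : {q : Fin 2 → ℝ | q 0 = q 1} = (LinearMap.ker L : Set (Fin 2 → ℝ)) := by
        ext q; simp [L, sub_eq_zero]
      have hne : LinearMap.ker L ≠ ⊤ := by
        intro h
        have hm : (![1, 0] : Fin 2 → ℝ) ∈ LinearMap.ker L := h ▸ Submodule.mem_top
        simp [L] at hm
      rw [hS]
      exact Measure.addHaar_submodule volume _ hne
    refine measure_mono_null (fun q ⟨hq, hn⟩ => ?_) hdiag
    simp only [mem_iUnion, Finset.mem_univ, exists_true_left, not_exists] at hn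
    have h0 : q ∉ cutDom c := hn 0
    have h1 : (fun j => q (Equiv.swap (0 : Fin 2) 1 j)) ∉ cutDom c := hn 1
    simp only [cutDom, mem_setOf_eq, not_and, not_lt, Equiv.swap_apply_left,
      Equiv.swap_apply_right] at h0 h1
    obtain ⟨a0, a1, a2, a3⟩ := hq
    show q 0 = q 1
    by_contra hne
    rcases lt_or_gt_of_ne hne with hlt | hlt
    · exact absurd a3 (not_lt.2 (h1 a0 hlt))
    · exact absurd a1 (not_lt.2 (h0 a2 hlt))
  · intro i _ j _ hij
    have key : ∀ i j, i < j → volume ((R i).domain ∩ (R j).domain) = 0 := by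
      intro i j hlt
      rw [show (R i).domain ∩ (R j).domain = ∅ from ?_, measure_empty]
      ext q
      simp only [mem_inter_iff, mem_empty_iff_false, iff_false, not_and]
      intro hi hj
      fin_cases i <;> fin_cases j <;> simp at hlt
      change q ∈ cutDom c at hi
      change (fun j => q (Equiv.swap (0 : Fin 2) 1 j)) ∈ cutDom c at hj
      simp only [cutDom, mem_setOf_eq, Equiv.swap_apply_left, Equiv.swap_apply_right] at hi hj
      linarith [hi.2.1, hj.2.1]
    rcases lt_or_gt_of_ne hij with hlt | hlt
    · exact key i j hlt
    · rw [inter_comm]; exact key j i hlt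

/-- **`[(0,u)²] − 2·[C(u)]` is a relation** (dissection + one permutation move). -/
theorem coSq_sub_two_nsmul : of (coSq c) - 2 • of (coRep c) ∈ relations := by
  have e : of (coSq c) - 2 • of (coRep c) =
      (of (coSq c) - of (coRep c) - of ((coRep c).reindex (Equiv.swap 0 1))) -
        (of (coRep c) - of ((coRep c).reindex (Equiv.swap 0 1))) := by
    rw [two_nsmul]; abel
  rw [e]
  exact sub_mem (coSq_dissect c) (of_sub_of_reindex_mem_relations _ _)

/-! ## Move (2): the co-square is the logarithmic box of `1/(1−u)` -/

/-- The affine chart `vᵢ = (1−qᵢ)/(1−u)`. -/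
def coChart (q : Fin 2 → ℝ) : Fin 2 → ℝ := ![(1 - c.x)⁻¹ * (1 - q 0), (1 - c.x)⁻¹ * (1 - q 1)]

/-- Its (constant) derivative `−(1−u)⁻¹·id`. -/
def coDeriv : (Fin 2 → ℝ) →L[ℝ] (Fin 2 → ℝ) :=
  ContinuousLinearMap.pi ![-((1 - c.x)⁻¹ • pr2 0), -((1 - c.x)⁻¹ • pr2 1)]

/-- The chart has the stated derivative. -/
theorem hasFDerivAt_coChart (q : Fin 2 → ℝ) : HasFDerivAt (coChart c) (coDeriv c) q := by
  rw [hasFDerivAt_pi']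
  intro i
  have hrow : (pr2 i).comp (coDeriv c) = ![-((1 - c.x)⁻¹ • pr2 0), -((1 - c.x)⁻¹ • pr2 1)] i :=
    ContinuousLinearMap.ext fun v => by simp [coDeriv]
  rw [hrow]
  fin_cases i
  · simpa [coChart, mul_sub] using
      ((hasFDerivAt_apply (0 : Fin 2) q).const_mul (1 - c.x)⁻¹).const_sub (1 - c.x)⁻¹
  · simpa [coChart, mul_sub] using
      ((hasFDerivAt_apply (1 : Fin 2) q).const_mul (1 - c.x)⁻¹).const_sub (1 - c.x)⁻¹

/-- The matrix of the derivative. -/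
theorem toMatrix_coDeriv :
    LinearMap.toMatrix' ((coDeriv c : (Fin 2 → ℝ) →L[ℝ] (Fin 2 → ℝ)) :
      (Fin 2 → ℝ) →ₗ[ℝ] (Fin 2 → ℝ)) = !![-(1 - c.x)⁻¹, 0; 0, -(1 - c.x)⁻¹] := by
  ext i j
  rw [LinearMap.toMatrix'_apply, ContinuousLinearMap.coe_coe]
  fin_cases i <;> fin_cases j <;> simp [coDeriv]

/-- `|det| = 1/(1−u)²`. -/
theorem abs_det_coDeriv : |(coDeriv c).det| = (1 - c.x)⁻¹ * (1 - c.x)⁻¹ := by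
  rw [ContinuousLinearMap.det, ← LinearMap.det_toMatrix', toMatrix_coDeriv, Matrix.det_fin_two_of]
  simp only [mul_zero, sub_zero, neg_mul_neg]
  exact abs_of_pos (mul_pos (inv_pos.2 c.symm_pos) (inv_pos.2 c.symm_pos))

/-- The chart is injective. -/
theorem injective_coChart : Function.Injective (coChart c) := by
  intro q q' h
  have hy : (1 - c.x)⁻¹ ≠ 0 := inv_ne_zero c.symm_pos.ne'
  have h0 := congrFun h 0
  have h1 := congrFun h 1
  simp only [coChart, Matrix.cons_val_zero, Matrix.cons_val_one] at h0 h1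
  have e0 := mul_left_cancel₀ hy h0
  have e1 := mul_left_cancel₀ hy h1
  funext i
  fin_cases i
  · show q 0 = q' 0
    linarith
  · show q 1 = q' 1
    linarith

/-- The chart maps the co-square onto the logarithmic box `(1, 1/(1−u))²`. -/
theorem image_coChart : coChart c '' coSqDom c = logBoxDom (1 - c.x)⁻¹ (1 - c.x)⁻¹ := by
  have hy := c.symm_pos
  have iy : (1 - c.x)⁻¹ * (1 - c.x) = 1 := inv_mul_cancel₀ hy.ne'
  ext v
  simp only [mem_image, coSqDom, logBoxDom, mem_setOf_eq]
  constructor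
  · rintro ⟨q, ⟨h1, h2, h3, h4⟩, rfl⟩
    simp only [coChart, Matrix.cons_val_zero, Matrix.cons_val_one]
    have a1 := mul_lt_mul_of_pos_left (by linarith : 1 - c.x < 1 - q 0) (inv_pos.2 hy)
    have a2 := mul_lt_mul_of_pos_left (by linarith : 1 - q 0 < 1) (inv_pos.2 hy)
    have a3 := mul_lt_mul_of_pos_left (by linarith : 1 - c.x < 1 - q 1) (inv_pos.2 hy)
    have a4 := mul_lt_mul_of_pos_left (by linarith : 1 - q 1 < 1) (inv_pos.2 hy)
    rw [mul_one] at a2 a4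
    exact ⟨by linarith, a2, by linarith, a4⟩
  · rintro ⟨h1, h2, h3, h4⟩
    have b1 := mul_lt_mul_of_pos_left h1 hy
    have b2 := mul_lt_mul_of_pos_left h2 hy
    have b3 := mul_lt_mul_of_pos_left h3 hy
    have b4 := mul_lt_mul_of_pos_left h4 hy
    rw [mul_inv_cancel₀ hy.ne'] at b2 b4
    rw [mul_one] at b1 b3
    refine ⟨![1 - (1 - c.x) * v 0, 1 - (1 - c.x) * v 1], ⟨?_, ?_, ?_, ?_⟩, ?_⟩
    · show 0 < 1 - (1 - c.x) * v 0
      linarith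
    · show 1 - (1 - c.x) * v 0 < c.x
      linarith
    · show 0 < 1 - (1 - c.x) * v 1
      linarith
    · show 1 - (1 - c.x) * v 1 < c.x
      linarith
    · funext i
      fin_cases i
      · show (1 - c.x)⁻¹ * (1 - (1 - (1 - c.x) * v 0)) = v 0
        rw [sub_sub_cancel, ← mul_assoc, iy, one_mul]
      · show (1 - c.x)⁻¹ * (1 - (1 - (1 - c.x) * v 1)) = v 1
        rw [sub_sub_cancel, ← mul_assoc, iy, one_mul]

/-- The chart is `ℚ`-semialgebraic: linear with algebraic coefficients. -/
theorem isSemialgebraicMapOn_coChart : IsSemialgebraicMapOn ℚ (coSqDom c) (coChart c) := by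
  have hS := isSemialgebraic_coSqDom c
  refine IsSemialgebraicMapOn.of_forall hS fun i => ?_
  fin_cases i
  · exact (IsSemialgebraicFunOn.mul_holds
      (isSemialgebraicFunOn_const_of_isAlgebraic hS c.symm.alg_inv)
      (isSemialgebraicFunOn_aeval hS (1 - X 0))).congr fun q _ => by simp [coChart]
  · exact (IsSemialgebraicFunOn.mul_holds
      (isSemialgebraicFunOn_const_of_isAlgebraic hS c.symm.alg_inv)
      (isSemialgebraicFunOn_aeval hS (1 - X 1))).congr fun q _ => by simp [coChart]

/-- `coFun` is the pull-back of `1/(v₀v₁)` under the affine chart. -/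
theorem coFun_eq_logSqFun_coChart (q : Fin 2 → ℝ) :
    coFun q = logSqFun (coChart c q) * ((1 - c.x)⁻¹ * (1 - c.x)⁻¹) := by
  have hy := c.symm_pos.ne'
  simp only [coFun, logSqFun, coChart, Matrix.cons_val_zero, Matrix.cons_val_one]
  by_cases h0 : 1 - q 0 = 0
  · simp [h0]
  by_cases h1 : 1 - q 1 = 0
  · simp [h1]
  field_simp

/-- **Affine move.** The co-square `≡` the logarithmic box `(1, 1/(1−u))²`. -/
theorem coSq_equiv_logBox : Equivalent (coSq c) (logBox c.symm.alg_inv c.symm.alg_inv) :=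
  equivalent_of_chart (isSemialgebraicMapOn_coChart c) (fun q _ => hasFDerivAt_coChart c q)
    (injective_coChart c).injOn (image_coChart c) (fun _ _ => abs_det_coDeriv c)
    (fun q _ => coFun_eq_logSqFun_coChart c q) rfl (fun _ _ => rfl) rfl (fun _ _ => rfl)

/-- **`2·[C(u)] = ℓ(1/(1−u))²`** in `Q`. -/
theorem two_nsmul_mkQ_coRep : 2 • mkQ (of (coRep c)) = ell (1 - c.x)⁻¹ ^ 2 := by
  have e : mkQ (of (logBox c.symm.alg_inv c.symm.alg_inv)) = ell (1 - c.x)⁻¹ * ell (1 - c.x)⁻¹ :=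
    mkQ_logBox _ _
  rw [sq, ← e, ← map_nsmul, mkQ_eq_mkQ_iff]
  have e' : 2 • of (coRep c) - of (logBox c.symm.alg_inv c.symm.alg_inv) =
      (of (coSq c) - of (logBox c.symm.alg_inv c.symm.alg_inv)) -
        (of (coSq c) - 2 • of (coRep c)) := by abel
  rw [e']
  exact sub_mem (coSq_equiv_logBox c) (coSq_sub_two_nsmul c)

/-! ## Landen's identity -/

section landen

variable {w : ℝ} (hw : IsAlgebraic ℚ w) (h0 : 0 < w)

/-- **Landen's identity as an identity of KZ classes.** For every real algebraic `w > 0`: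
`2·[D⁻(w)] = 2·[D(w/(1+w))] + ℓ(1+w)²` in `Q = FormalRep/relations`. -/
theorem two_nsmul_mkQ_dilogNeg : 2 • mkQ (of (dilogNeg hw h0)) =
    2 • mkQ (of (dilogCut (Cut.ofPos hw h0))) + ell (1 + w) ^ 2 := by
  rw [mkQ_dilogNeg, smul_add, two_nsmul_mkQ_coRep, Cut.inv_one_sub_ofPos_x]

/-- **Landen's identity for the periods**: `−Li₂(−w) = Li₂(w/(1+w)) + ½ log²(1+w)`, i.e.
`value D⁻(w) = value D(w/(1+w)) + log²(1+w)/2`, read off the moves. -/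
theorem dilogNeg_value : (dilogNeg hw h0).value =
    (dilogCut (Cut.ofPos hw h0)).value + Real.log (1 + w) ^ 2 / 2 := by
  have h := congrArg evalQ (two_nsmul_mkQ_dilogNeg hw h0)
  have e : evalQ (ell (1 + w)) = Real.log (1 + w) :=
    evalQ_ell (isAlgebraic_one.add hw) (by linarith)
  rw [map_add, map_nsmul, map_nsmul, map_pow, evalQ_mkQ, evalQ_mkQ, eval_of, eval_of, e,
    nsmul_eq_mul, nsmul_eq_mul, Nat.cast_ofNat] at h
  linarith

end landen

end SoloBlind

end Summit.KontsevichZagierPeriods.KontsevichZagierPeriods.Theorems
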